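import Literature.MathematicalPhysics.QuantumFieldTheory.Balaban1983to89.B9Thm314HFlatV1MultiLevelTorus
import Literature.MathematicalPhysics.QuantumFieldTheory.Balaban1983to89.B9Thm314GFlatV1Holder
import Literature.MathematicalPhysics.QuantumFieldTheory.Balaban1983to89.B6Cor28HolderUnifKLevelV1

/-!
# `Balaban1983to89.B9Thm314HFlatV1Holder` — [B9] THEOREM 3.14 (pp. 426–427, (3.154)) AT `U = 1` ON THE V1 TORUS, FILE H3: THE HÖLDER PAIR
MEMBERS — (§1) (2.137)₁ FOR THE GENUINE `k`-LEVEL `G = Δ_a⁻¹`, UNCONDITIONAL: `|[(∇_νG[Ω]μ)(x) − (∇_νG[Ω]μ)(x′)] − [(∇_νG[Ω′]μ)(x) − (∇_νG[Ω′]μ)(x′)]|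
≤ C·(|x − x′|_∞/L^k)^α·(L^k·|c_f|⁻¹)·|μ|·e^{−δ·min(d,d′)(y,y′)}·e^{−δ·d(y,y′,Ω)}`; (§2) (2.151)₃ FOR THE GENUINE `H = GQ*(QGQ*)⁻¹`, UNCONDITIONAL:
`|[(∇_νH[Ω]e_c)(x) − (∇_νH[Ω]e_c)(x′)] − [(∇_νH[Ω′]e_c̃)(x) − (∇_νH[Ω′]e_c̃)(x′)]| ≤ C·(|x − x′|_∞/L^k)^α·(L^k·|c_f|⁻¹)⁻¹·e^{−δ·min(d_T(y(x),βc), d_T′(y′(x),β′c̃))}·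
e^{−δ·d(y(x), βc, Ω)}` — the instance `T = P_{x,x′}∇_νG` of the generic-left-factor engine `B9Thm314HFlatV1Transfer.thm314_TH_of_hyps`
(theorems only; no existing module is touched; no definition, no fact is minted)

HEADER.  Unit `lit-balaban-p21` (literature-prover, Phase-2 proof seat), GENERATION 24, 2026-08-25; referee-facing records under
`run/shared/lean/pub/lit-balaban/`.  T. Bałaban, *Propagators for lattice gauge theories in a background field*, Commun. Math.
Phys. **99** (1985) 389–434 [Balaban1985BackgroundPropagators] = [B9], Sect. D, Theorem 3.14; [4] = T. Bałaban, *Propagators and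
renormalization transformations for lattice gauge theories. II*, Commun. Math. Phys. **96** (1984) 223–250 [Balaban1984PropagatorsII],
Prop. 2.6 (2.137) p. 247, Corollary 2.8 (2.150)–(2.151) p. 249; [Balaban1984PropagatorsI] (1.109) p. 35 (the Hölder pair quotient).

FRAMING (verbatim cell line): statement-level skeleton of published theorems with citation tags; proofs where landed; nothing
here is a claim about the Yang–Mills mass gap.

SKELETON ROW: B9.Thm3.14 (owner r06) × B6.Prop2.6 ∕ B6.Cor2.8 (owner r03), cross-reference cells only.  Inputs BY NAME (nothing restated):
this seat's `B9Thm314GFlatV1Holder.thm314_gradG_holder_flat_V1_of_majorants` (gen 21: the two-family (2.137)₁ modulo the one-family pair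
majorants), r03's `B6Cor28HolderUnifKLevelV1.ineq2137_grad_kLevel_unif` (the one-family pair majorant of `P_{x,x′}∇_νG`, threshold uniform in
`α`; p22's (2.137)₁ programme) and `B6Cor28HolderUnifKLevelV1.cor28_kLevel_holderPair` ((2.151)₃ as pair differences at k levels),
`B6QGQCoerciveKLevelV1.prop27_kLevel_unconditional` ((2.149)), this seat's `B9Thm314QGQInvFlatV1MultiLevelTorus.thm314_QGQinv_flat_V1`,
`B9Thm314HFlatV1Transfer.thm314_TH_of_hyps` (H1), the §1 reshaping lemmas of `B9Thm314HFlatV1MultiLevelTorus` (H2),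
`B9Thm314GpFlatMultiLevelTorus.consts_260_261`, r03's `B6Cor28KLevelV1.absorb_threshold`.

WHAT IS PRINTED.  [B9] p. 426: «Let us take localizations determined by points y, y′ ∈ Ω^{(k)} (i.e. these are cubes Δ(y), Δ(y′) in
the case of operators G′, G, G₁, 𝔊, the cube Δ(y) and the point y′ in the case of H, H₁, and the points y, y′ in the case of
(Q′G′²Q′*)⁻¹, (QGQ*)⁻¹, etc.).»; p. 427: «**Theorem 3.14.** If we take a pair of operators constructed for the two sequences {Ω_j},
{Ω′_j}, then their difference satisfies all the inequalities characteristic for operators of the considered type, with the additional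
factor exp(−δ₀d(y, y′, Ω)), d(y, y′, Ω) = inf_{y₁∈Ωᶜ∩T^{(k)}}(|y − y₁| + |y₁ − y′|) (3.154) on the right-hand sides.»  [4] p. 247: «**Proposition 2.6.** …
‖ζGJ‖_α, ‖ζ∇GJ‖_α, ‖ζG∇*J‖_α ≤ O(1)[(Lʲη)^{2−α}, (Lʲη)^{1−α}, (Lʲη)^{1−α}](‖ζ‖_α + |ζ|)e^{−δ₃d(y,y′)}|J| (2.137)»; p. 249: «A kernel of the
operator H, (HB)(b) = Σ_{c∈𝔅}(L^{j(c)}η)^d H(b, c)B(c), (2.150) satisfies the inequality |H(b, c)|, |(∇H)(b, c)|, ‖(ζ∇H)(·, c)‖_α ≤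
O(1)[1, (L^jη)^{−1}, (L^jη)^{−1−α}(‖ζ‖_α + |ζ|)](L^{j′}η)^{−d}e^{−δ₅d(y,c₋)}, (1.151) b ∈ Δ(y) or supp ζ ⊂ Δ(y), y ∈ Λ_j, c₋ ∈ Λ_{j′}.».

## WHAT THIS FILE CERTIFIES (kernel-checked, sorry-free, standard axioms; lattice units, `D = d + 1`, `L = ℓ + 1`; THEOREMS ONLY)

* §0 the instance `T = P_{x,x′}∇_νG` of the engine: `((P_{x,x′}·∇_ν·onFun G) ∘ Q*E)g(x) = (∇_νHg)(x) − (∇_νHg)(x′)` (`holderH_apply_eq_comp`),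
  the operator bookkeeping `P·∇·onFun G = P ∘ (∇ ∘ onFun G)` (`pairOp_mul_eq_comp`), a square-root identity;
* §1 **`thm314_gradG_holderPair_flat_V1`** — THEOREM 3.14 AT `U = 1`, THE (2.137)₁ MEMBER (pair differences of `∇_νG`, `G = Δ_a⁻¹`),
  UNCONDITIONAL, the «M sufficiently large» threshold uniform in `α ∈ [0,1)`: there are `δ, M₀, N₀ > 0` and, for every `α ∈ [0, 1)`, `C > 0`
  such that for every V1 torus, two nested families with `k ≥ 2`, the ROUTE-V side conditions, band weights agreeing on common index pairs,
  every direction `ν`, fine bonds `x, x′` of the same direction with `x ∈ Ω = Ω_k ∩ Ω′_k` (both levels `= k` at its site) and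
  `|x − x′|_∞ ≤ L^k, L^{j(x′)}, L^{j′(x′)}`, every common top block `y′` and `supp μ ⊂ B′(y′)`, `|μ| ≤ B`:
  `|[(∇_νG[Ω]μ)(x) − (∇_νG[Ω]μ)(x′)] − [(∇_νG[Ω′]μ)(x) − (∇_νG[Ω′]μ)(x′)]| ≤ C·((|x−x′|_∞/L^k)^α·(len(y(x))·|c_f|⁻¹)·B)·e^{−δ·min(d_T(y(x),y′), d_T′(y′(x),y′))}·e^{−δ·d(y(x),y′,Ω)}`;
* §2 **`thm314_gradH_holderPair_flat_V1`** — THEOREM 3.14 AT `U = 1`, THE (2.151)₃ MEMBER (pair differences of `∇_νH`, `H = GQ*(QGQ*)⁻¹ =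
  GE ∘ QsE ∘ EE (domT hN D hk)`), UNCONDITIONAL, thresholds uniform in `α`: with the same data and a common top index bond `c` (twin `c̃`):
  `|[(∇_νH[Ω]e_c)(x) − (∇_νH[Ω]e_c)(x′)] − [(∇_νH[Ω′]e_c̃)(x) − (∇_νH[Ω′]e_c̃)(x′)]| ≤ C·(|x−x′|_∞/L^k)^α·(len(y(x))·|c_f|⁻¹)⁻¹·e^{−δ·min(d_T(y(x),βc), d_T′(y′(x),β′c̃))}·e^{−δ·d(y(x),βc,Ω)}`
  — r03's one-family (2.151)₃ `cor28_kLevel_holderPair` «with the additional factor exp(−δ₀d(y, y′, Ω))».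

## HONEST SCOPE

(1) `U = 1` only; V1 torus lineage; the Hölder members as PAIR DIFFERENCES at two fine bonds `x, x′` (print's `‖·‖_α` over a cube with a
cutoff `ζ` is the supremum of these quotients; the `ζ`-weighted norm form is not re-derived here — exactly the form of r03's one-family
`cor28_kLevel_holderPair` and of p22's (2.137)₁ lane); `x` in `Ω` with both levels `k`, common top index bonds only (print's «y, y′ ∈ Ω^{(k)}»).
(2) No level factor `(L^{j′}η)^{−d}` (flat `ℓ²(𝔅)` entries, as in r03's Cor. 2.8 files); the Hölder gain `(|x − x′|_∞/L^k)^α` is print's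
`|x − x′|^α·(L^jη)^{−α}` in lattice units at the top level.  (3) Decay `e^{−δ·min(d_T, d_T′)}` (geometric mean of the `Ω`-bound with the trivial
bound); constants existential, ours; thresholds `M₀, N₀` and the rate `δ` chosen BEFORE the exponent `α`, the constant `C` after it (the
quantifier order of r03's `ineq2137_grad_kLevel_unif` ∕ `cor28_kLevel_holderPair`).  (4) Route as in H1 (transfer identity, not the walk
cancellation).  NOT summit progress.

v1.1 (doc-only, D-g110-2 of ref-4 gen 110): the (3.154) display in the Theorem 3.14 quotation above now reads verbatim «d(y, y′, Ω) = inf_{y₁∈Ωᶜ∩T^{(k)}}(|y − y₁| + |y₁ − y′|)» (v1.0 had «inf_{x∈Ωᶜ}(|y − x| + |x − y′|)»); declarations byte-identical.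
-/

noncomputable section

open scoped BigOperators InnerProductSpace
open Finset

namespace Literature.MathematicalPhysics.QuantumFieldTheory.Balaban1983to89.B9Thm314HFlatV1Holder

open LatticeFieldCalculus (supDist)
open B4Reflection242 (boxDom blk)
open B6MultiLevelBoxOperator (N0)
open B6MultiLevelTorusOperator (TDomains)
open B6Geom246MultiLevelBox (bset blkOf)
open B6Geom246MultiLevelTorus (geomT)
open B6SectAOperatorsV1 (QE QsE BondIdx BondIdxSpace)
open B6SectAVectorModelV1 (GE EE)
open B6GlobalChartV1 (PV toBox domT blkV1)
open B6Ineq2142KLevelV1 (lvl β)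
open B6Prop27KLevelV1 (wt lam lam_pos rho rho_isPseudoDist)
open B6QGQCoerciveKLevelV1 (gam0 gam0_pos prop27_kLevel_unconditional)
open B6RandomWalk (HasMajorant BlockSupp hasMajorant_mono delta3 delta3_pos)
open B6Ineq2133TwoScaleV1 (onFun)
open B6Prop26KLevelSkeletonV1 (pref pref_nonneg)
open B6Prop26KLevelAssemblyV1 (distT_nonneg)
open B6GradLegKLevelV1 (DV)
open B6HolderPairMemberV1 (pairOp pairOp_apply pairOp_mul_apply)
open B6Lemma21Repaired (Ineq261With)
open B6Cover236MultiLevelBlocks (cubes)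
open B6CubeWindowV1 (Placed GlobalBand)
open B6Cor28KLevelV1 (absorb_threshold two_le_RMh onFun_comp pref_pos)
open B6Cor28HolderUnifKLevelV1 (ineq2137_grad_kLevel_unif cor28_kLevel_holderPair)
open B8Ineq192MultiLevelTorus (geomT_len)
open B9Thm314GpFlatTorusGeometry (dOmega dOmega_nonneg)
open B9Thm314GpFlatMultiLevelTorus (consts_260_261)
open B9Thm314GFlatV1Kernel (IsCT)
open B9Thm314GFlatV1Holder (thm314_gradG_holder_flat_V1_of_majorants)
open B9Thm314QGQInvFlatV1MultiLevelTorus (thm314_QGQinv_flat_V1 exp_weaken)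
open B9Thm314HFlatV1Transfer (thm314_TH_of_hyps blkV1_common_top)
open B9Thm314HFlatV1MultiLevelTorus (inner_weaken twoFamily_weaken hasMajorant_weaken pref_eq_len_sq len_mul_inv_pos)

variable {d ℓ m K : ℕ} {hd : 1 ≤ d + 1} {hL : Odd (ℓ + 1) ∧ 1 < ℓ + 1}
variable {Mh k R : ℕ} {P' : Fin (d + 1) → ℕ}

/-! ## §0  The instance `T = P_{x,x′}∇_νG` of the engine -/

section Instance

variable (hN : ∀ μ, N0 ℓ Mh k P' μ = (PV d ℓ m K hd hL).sitesPerDir 0) (D₀ : TDomains d ℓ Mh k P' R) (hk : k ≤ m + K)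
variable {cf : ℝ} (hcf : cf ≠ 0) {w : BondIdx (domT hN D₀ hk) → ℝ} (hw : ∀ i, 0 < w i)

/-- operator bookkeeping: `P_{x,x′}·∇_ν·onFun G = P_{x,x′} ∘ (∇_ν ∘ onFun G)` (the product of `Module.End` is composition).
[cite: Balaban1984PropagatorsI, (1.109) p.35, dictionary] -/
theorem pairOp_mul_eq_comp (ν : Fin (d + 1)) (x x' : PBond (PV d ℓ m K hd hL) 0) :
    pairOp x x' * DV (P := PV d ℓ m K hd hL) ν cf * onFun (GE (domT hN D₀ hk) hcf hw) = pairOp x x' ∘ₗ (DV ν cf ∘ₗ onFun (GE (domT hN D₀ hk) hcf hw)) := by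
  rw [mul_assoc]; rfl

/-- `((P_{x,x′}·∇_ν·onFun G) ∘ onFun(Q*E))g` at `x` is the pair difference `(∇_νHg)(x) − (∇_νHg)(x′)` of `∇_νH = ∇_ν ∘ onFun(G ∘ Q*E)`.
[cite: Balaban1984PropagatorsII, (2.130) p.246, (2.150)–(2.151) p.249; Balaban1984PropagatorsI, (1.109) p.35, dictionary] -/
theorem holderH_apply_eq_comp (ν : Fin (d + 1)) (x x' : PBond (PV d ℓ m K hd hL) 0) (g : BondIdx (domT hN D₀ hk) → ℝ) :
    ((pairOp x x' * DV (P := PV d ℓ m K hd hL) ν cf * onFun (GE (domT hN D₀ hk) hcf hw)) ∘ₗ onFun (QsE (domT hN D₀ hk) ∘ₗ EE (domT hN D₀ hk) hcf hw)) g x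
      = (DV ν cf ∘ₗ onFun (GE (domT hN D₀ hk) hcf hw ∘ₗ QsE (domT hN D₀ hk) ∘ₗ EE (domT hN D₀ hk) hcf hw)) g x
        - (DV ν cf ∘ₗ onFun (GE (domT hN D₀ hk) hcf hw ∘ₗ QsE (domT hN D₀ hk) ∘ₗ EE (domT hN D₀ hk) hcf hw)) g x' := by
  rw [LinearMap.comp_apply, mul_assoc, pairOp_mul_apply, if_pos rfl, onFun_comp]
  rfl

omit hd hL in
/-- `√(a·r)·√(b·r) = √a·√b·r` for `a, b, r ≥ 0` (the geometric mean carries the common output factor).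
[cite: Balaban1985BackgroundPropagators, (3.154) p.427, bookkeeping] -/
theorem sqrt_mul_sqrt_factor {a b r : ℝ} (ha : 0 ≤ a) (hb : 0 ≤ b) (hr : 0 ≤ r) :
    Real.sqrt (a * r) * Real.sqrt (b * r) = Real.sqrt a * Real.sqrt b * r := by
  rw [Real.sqrt_mul ha, Real.sqrt_mul hb]
  have hs := Real.mul_self_sqrt hr
  calc Real.sqrt a * Real.sqrt r * (Real.sqrt b * Real.sqrt r) = Real.sqrt a * Real.sqrt b * (Real.sqrt r * Real.sqrt r) := by ring
    _ = _ := by rw [hs]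

end Instance

/-! ## §1  THEOREM 3.14 AT `U = 1`: the (2.137)₁ member (pair differences of `∇_νG`) for `G = Δ_a⁻¹`, UNCONDITIONAL -/

section HolderG

/-- **[B9] THEOREM 3.14 (3.154) AT `U = 1` — THE HÖLDER MEMBER (2.137)₁ (PAIR DIFFERENCES OF `∇_νG`) FOR THE GENUINE `k`-LEVEL `G = Δ_a⁻¹`
OF TWO NESTED FAMILIES ON THE V1 TORUS, UNCONDITIONAL.**  There are `δ, M₀, N₀ > 0` and, for every `α ∈ [0, 1)`, `C > 0` (on `d, L, b₀, b₁`,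
`α` only) such that for every V1 torus, every two nested families `D, D′` with `k ≥ 2` levels, `M_h = L^a ≥ 8`, `R ≥ 2L²`, `P′ ≥ 5L`, `L ≥ 5`
odd, placed cubes for both, `M₀ ≤ L·M_h`, `N₀ + 1 ≤ R·L·M_h`, `c_f ≠ 0`, band weights agreeing on common index pairs, every direction `ν`,
fine bonds `x, x′` of one direction with both levels `= k` at the site of `x` and `|x − x′|_∞ ≤ L^k, L^{j(x′)}, L^{j′(x′)}`, every common
top block `y′` and `supp μ ⊂ B′(y′)`, `|μ| ≤ B`:
`|[(∇_νG[Ω]μ)(x) − (∇_νG[Ω]μ)(x′)] − [(∇_νG[Ω′]μ)(x) − (∇_νG[Ω′]μ)(x′)]| ≤ C·((|x−x′|_∞/L^k)^α·(len(y(x))·|c_f|⁻¹)·B)·e^{−δ·min(d_T(y(x),y′), d_T′(y′(x),y′))}·e^{−δ·d(y(x),y′,Ω)}`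
— this seat's `thm314_gradG_holder_flat_V1_of_majorants` with its two pair majorants DISCHARGED by r03's `ineq2137_grad_kLevel_unif` (fed
with `A₃ = 1`, the constant `A(α)` inside the prefactor, so that `δ, M₀, N₀` do not depend on `α`).
[cite: Balaban1985BackgroundPropagators, Thm 3.14 (3.153)–(3.154) pp.426–427; Balaban1984PropagatorsII, Prop. 2.6 (2.137) p.247; Balaban1984PropagatorsI, (1.109) p.35] -/
theorem thm314_gradG_holderPair_flat_V1 (d ℓ : ℕ) (hd : 1 ≤ d + 1) (hL : Odd (ℓ + 1) ∧ 1 < ℓ + 1) {b₀ b₁ : ℝ} (hb₀ : 0 < b₀)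
    (hb₁ : b₀ ≤ b₁) :
    ∃ δ M₀ : ℝ, ∃ N₀ : ℕ, 0 < δ ∧ 0 < M₀ ∧ 0 < N₀ ∧ ∀ α : ℝ, 0 ≤ α → α < 1 → ∃ C : ℝ, 0 < C ∧
      ∀ (m K : ℕ) {Mh k R : ℕ} {P' : Fin (d + 1) → ℕ}
        (hN : ∀ μ, N0 ℓ Mh k P' μ = (PV d ℓ m K hd hL).sitesPerDir 0) (D D' : TDomains d ℓ Mh k P' R) (hk : k ≤ m + K),
        2 ≤ k → ∀ {a : ℕ}, Mh = (ℓ + 1) ^ a → 8 ≤ Mh → 2 * (ℓ + 1) ^ 2 ≤ R → (∀ μ, 5 * (ℓ + 1) ≤ P' μ) → 4 ≤ ℓ →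
        (∀ c : ↥(cubes D.toDomains), Placed ℓ k P' c.1) → (∀ c : ↥(cubes D'.toDomains), Placed ℓ k P' c.1) →
        M₀ ≤ ((ℓ : ℝ) + 1) * Mh → N₀ + 1 ≤ R * ((ℓ + 1) * Mh) →
        ∀ {cf : ℝ} (hcf : cf ≠ 0) {w : BondIdx (domT hN D hk) → ℝ} (hw : ∀ i, 0 < w i)
          {w' : BondIdx (domT hN D' hk) → ℝ} (hw' : ∀ i', 0 < w' i'),
        GlobalBand b₀ b₁ cf w → GlobalBand b₀ b₁ cf w' →
        (∀ (i : BondIdx (domT hN D hk)) (i' : BondIdx (domT hN D' hk)), i.1 = i'.1 → w i = w' i') →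
        ∀ (ν : Fin (d + 1)) (x x' : PBond (PV d ℓ m K hd hL) 0), x.dir = x'.dir →
        D.lev (toBox hN x.src).1 = k → D'.lev (toBox hN x.src).1 = k →
        supDist x.src x'.src ≤ (ℓ + 1) ^ k → supDist x.src x'.src ≤ (ℓ + 1) ^ (blkV1 hN D x').1.1 →
        supDist x.src x'.src ≤ (ℓ + 1) ^ (blkV1 hN D' x').1.1 →
        ∀ (y' : ↥(bset D'.toDomains)) (hy'D : y'.1 ∈ bset D.toDomains), y'.1.1 = k →
        ∀ (μ : PBond (PV d ℓ m K hd hL) 0 → ℝ) (B : ℝ), BlockSupp (g := geomT D') (blkV1 hN D') μ y' B →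
          |((DV ν cf ∘ₗ onFun (GE (domT hN D hk) hcf hw)) μ x - (DV ν cf ∘ₗ onFun (GE (domT hN D hk) hcf hw)) μ x')
              - ((DV ν cf ∘ₗ onFun (GE (domT hN D' hk) hcf hw')) μ x - (DV ν cf ∘ₗ onFun (GE (domT hN D' hk) hcf hw')) μ x')|
            ≤ C * ((((supDist x.src x'.src : ℕ) : ℝ) / (((ℓ + 1 : ℕ) : ℝ)) ^ k) ^ α * ((geomT D).len (blkV1 hN D x) * |cf|⁻¹) * B)
              * Real.exp (-(δ * min ((geomT D).dist (blkV1 hN D x) ⟨y'.1, hy'D⟩) ((geomT D').dist (blkV1 hN D' x) y')))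
              * Real.exp (-(δ * dOmega D D' (blkV1 hN D x).1.2 y'.1.2)) := by
  -- the one-family pair majorants (r03/p22), `σ = σ₁`, `β = ½`: the threshold `M₂` BEFORE `α`, the constant `A` after it
  obtain ⟨σ₁, hσ₁, hU⟩ := ineq2137_grad_kLevel_unif d ℓ hd hL hb₀ hb₁
  obtain ⟨M₂, hM₂, hUα⟩ := hU σ₁ hσ₁ le_rfl (1 / 2) (by norm_num) (by norm_num)
  have hδ₃ : 0 < delta3 (1 / 2) (2 * σ₁) := delta3_pos (by norm_num) (by linarith)
  -- the two-family engine of gen 21 at `A₃ = 1`, `δ₃ = delta3 ½ (2σ₁)`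
  obtain ⟨δ, C₁, M₀, N₀, hδ, hC₁, hM₀, hN₀, hG21⟩ :=
    thm314_gradG_holder_flat_V1_of_majorants d ℓ hd hL hb₀ hb₁ (A₃ := 1) zero_le_one hδ₃
  refine ⟨δ, max M₀ M₂, N₀, hδ, lt_max_of_lt_left hM₀, hN₀, fun α hα0 hα1 => ?_⟩
  obtain ⟨A, hA, hUA⟩ := hUα α hα0 hα1
  refine ⟨C₁ * (A + 1), mul_pos hC₁ (by linarith), ?_⟩
  intro m K Mh k R P' hN D D' hk hk2 a hMha hM8 hR hP5L hℓ hplD hplD' hM hNR cf hcf w hw w' hw' hB hB' hww ν x x' hdir hxD hxD'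
    hs hsD hsD' y' hy'D hy'k μ B hμ
  have hk1 : 1 ≤ k := le_trans (by norm_num) hk2
  have hP5 : ∀ μ, 5 ≤ P' μ := fun μ => le_trans (Nat.le_mul_of_pos_right 5 (Nat.succ_pos ℓ)) (hP5L μ)
  have hM₀' : M₀ ≤ ((ℓ : ℝ) + 1) * Mh := le_trans (le_max_left _ _) hM
  have hM₂' : M₂ ≤ ((ℓ : ℝ) + 1) * Mh := le_trans (le_max_right _ _) hM
  obtain ⟨hy, hyD', hy', hy'D2, hlab⟩ := blkV1_common_top hN D D' x hxD hxD'
  have hyy : (⟨(blkV1 hN D x).1, hyD'⟩ : ↥(bset D'.toDomains)) = blkV1 hN D' x :=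
    Subtype.ext (Prod.ext (hy.trans hy'.symm) hlab.symm)
  -- the Hölder gain and the prefactors
  set t : ℝ := (((supDist x.src x'.src : ℕ) : ℝ) / (((ℓ + 1 : ℕ) : ℝ)) ^ k) ^ α with ht
  have ht0 : 0 ≤ t := Real.rpow_nonneg (by positivity) _
  have hlen0 : ∀ a : ↥(bset D.toDomains), 0 ≤ (geomT D).len a * |cf|⁻¹ := fun a => (len_mul_inv_pos D hcf a).le
  have hlen0' : ∀ a : ↥(bset D'.toDomains), 0 ≤ (geomT D').len a * |cf|⁻¹ := fun a => (len_mul_inv_pos D' hcf a).le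
  have hφ0 : ∀ a : ↥(bset D.toDomains), 0 ≤ A * (t * ((geomT D).len a * |cf|⁻¹)) := fun a =>
    mul_nonneg hA (mul_nonneg ht0 (hlen0 a))
  have hφ0' : ∀ a : ↥(bset D'.toDomains), 0 ≤ A * (t * ((geomT D').len a * |cf|⁻¹)) := fun a =>
    mul_nonneg hA (mul_nonneg ht0 (hlen0' a))
  have hφeq : (fun a : ↥(bset D'.toDomains) => A * (t * ((geomT D').len a * |cf|⁻¹))) ⟨(blkV1 hN D x).1, hyD'⟩
      = A * (t * ((geomT D).len (blkV1 hN D x) * |cf|⁻¹)) := rfl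
  -- the one-family pair majorants of both families, levels of `x` read as `k`, reshaped for the engine
  have hsD1 : supDist x.src x'.src ≤ (ℓ + 1) ^ (blkV1 hN D x).1.1 := by rw [hy]; exact hs
  have hsD'1 : supDist x.src x'.src ≤ (ℓ + 1) ^ (blkV1 hN D' x).1.1 := by rw [hy']; exact hs
  have hMD := hUA m K hN D hk hk2 hMha hM8 hR hP5 hℓ hplD hM₂' hcf hw hB ν x x' hdir hsD1 hsD
  have hMD' := hUA m K hN D' hk hk2 hMha hM8 hR hP5 hℓ hplD' hM₂' hcf hw' hB' ν x x' hdir hsD'1 hsD'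
  rw [hy, pairOp_mul_eq_comp] at hMD
  rw [hy', pairOp_mul_eq_comp] at hMD'
  have hT : HasMajorant (g := geomT D) (blkV1 hN D) (pairOp x x' ∘ₗ (DV ν cf ∘ₗ onFun (GE (domT hN D hk) hcf hw)))
      (fun a b => 1 * (A * (t * ((geomT D).len a * |cf|⁻¹))) * Real.exp (-(delta3 (1 / 2) (2 * σ₁) * (geomT D).dist a b))) :=
    hasMajorant_mono (g := geomT D) (blkV1 hN D) hMD fun a b => le_of_eq (by rw [ht]; ring)
  have hT' : HasMajorant (g := geomT D') (blkV1 hN D') (pairOp x x' ∘ₗ (DV ν cf ∘ₗ onFun (GE (domT hN D' hk) hcf hw')))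
      (fun a b => 1 * (A * (t * ((geomT D').len a * |cf|⁻¹))) * Real.exp (-(delta3 (1 / 2) (2 * σ₁) * (geomT D').dist a b))) :=
    hasMajorant_mono (g := geomT D') (blkV1 hN D') hMD' fun a b => le_of_eq (by rw [ht]; ring)
  -- the two-family engine
  have h := hG21 m K hN D D' hk hk1 hMha hM8 hR hP5L hℓ hM₀' hNR hcf hw hw' hB hB' hww (blkV1 hN D x) hyD' y' hy'D hy hy'k ν x x'
    (fun a => A * (t * ((geomT D).len a * |cf|⁻¹))) (fun a => A * (t * ((geomT D').len a * |cf|⁻¹))) hφ0 hφ0' hφeq hT hT' μ B hμ rfl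
  rw [hyy] at h
  refine h.trans ?_
  have hXB : 0 ≤ t * ((geomT D).len (blkV1 hN D x) * |cf|⁻¹) * B := mul_nonneg (mul_nonneg ht0 (hlen0 _)) hμ.nonneg
  have hK : C₁ * (A * (t * ((geomT D).len (blkV1 hN D x) * |cf|⁻¹)) * B)
      ≤ C₁ * (A + 1) * (t * ((geomT D).len (blkV1 hN D x) * |cf|⁻¹) * B) := by
    rw [show C₁ * (A * (t * ((geomT D).len (blkV1 hN D x) * |cf|⁻¹)) * B)
        = C₁ * A * (t * ((geomT D).len (blkV1 hN D x) * |cf|⁻¹) * B) by ring]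
    exact mul_le_mul_of_nonneg_right (mul_le_mul_of_nonneg_left (le_add_of_nonneg_right zero_le_one) hC₁.le) hXB
  have hK0 : 0 ≤ C₁ * (A + 1) * (t * ((geomT D).len (blkV1 hN D x) * |cf|⁻¹) * B) :=
    mul_nonneg (mul_nonneg hC₁.le (by linarith)) hXB
  exact mul_le_mul (mul_le_mul_of_nonneg_right hK (Real.exp_pos _).le) le_rfl (Real.exp_pos _).le
    (mul_nonneg hK0 (Real.exp_pos _).le)

end HolderG

/-! ## §2  THEOREM 3.14 AT `U = 1`: the (2.151)₃ member (pair differences of `∇_νH`) for `H = GQ*(QGQ*)⁻¹`, UNCONDITIONAL -/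

section HolderH

/-- **[B9] THEOREM 3.14 (3.154) AT `U = 1` — THE HÖLDER ENTRY (2.151)₃ (PAIR DIFFERENCES OF `∇_νH`) FOR THE GENUINE `k`-LEVEL
`H = GQ*(QGQ*)⁻¹ = GE ∘ QsE ∘ EE (domT hN D hk)` OF TWO NESTED FAMILIES ON THE V1 TORUS, UNCONDITIONAL.**  There are `δ, M₀ > 0`, `N₀` and,
for every `α ∈ [0, 1)`, `C > 0` (on `d, L, b₀, b₁`, `α` only) such that for every V1 torus, every two nested families `D, D′` with `k ≥ 2`
levels, `M_h = L^a ≥ 8`, `R ≥ 2L²`, `P′ ≥ 5L`, `L ≥ 5` odd, placed cubes for both, `M₀ ≤ L·M_h`, `N₀ + 1 ≤ R·L·M_h`, `c_f ≠ 0`, band weights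
agreeing on common index pairs, every direction `ν`, fine bonds `x, x′` of one direction with both levels `= k` at the site of `x` (print's
«cube Δ(y), y ∈ Ω^{(k)}») and `|x − x′|_∞ ≤ L^k, L^{j(x′)}, L^{j′(x′)}`, and every COMMON TOP index bond `c` (print's «point y′», twin `c̃`):
`|[(∇_νH[Ω]e_c)(x) − (∇_νH[Ω]e_c)(x′)] − [(∇_νH[Ω′]e_c̃)(x) − (∇_νH[Ω′]e_c̃)(x′)]| ≤ C·(|x−x′|_∞/L^k)^α·(len(y(x))·|c_f|⁻¹)⁻¹·e^{−δ·min(d_T(y(x),βc), d_T′(y′(x),β′c̃))}·e^{−δ·d(y(x),βc,Ω)}`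
— print's «their difference satisfies all the inequalities characteristic for operators of the considered type [(2.151)₃, r03's
`cor28_kLevel_holderPair`: `≤ C·(|x−x′|_∞/L^{j})^α·(len(y(x))·|c_f|⁻¹)⁻¹·e^{−δ₅d_T(y(x),βc)}`], with the additional factor exp(−δ₀d(y, y′, Ω))».
The instance `T = P_{x,x′}·∇_ν·onFun G`, `Φ(y) = (|x−x′|_∞/L^k)^α·len(y)·|c_f|⁻¹` of H1's `thm314_TH_of_hyps`.
[cite: Balaban1985BackgroundPropagators, Thm 3.14 (3.154) pp.426–427; Balaban1984PropagatorsII, Cor. 2.8 (2.150)–(2.151) p.249, Prop. 2.6 (2.137) p.247, Prop. 2.7 (2.149) p.249, Lemma 2.1 (2.60)–(2.61) p.234; Balaban1984PropagatorsI, (1.109) p.35] -/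
theorem thm314_gradH_holderPair_flat_V1 (d ℓ : ℕ) (hd : 1 ≤ d + 1) (hL : Odd (ℓ + 1) ∧ 1 < ℓ + 1) {b₀ b₁ : ℝ} (hb₀ : 0 < b₀)
    (hb₁ : b₀ ≤ b₁) :
    ∃ δ M₀ : ℝ, ∃ N₀ : ℕ, 0 < δ ∧ 0 < M₀ ∧ ∀ α : ℝ, 0 ≤ α → α < 1 → ∃ C : ℝ, 0 < C ∧
      ∀ (m K : ℕ) {Mh k R : ℕ} {P' : Fin (d + 1) → ℕ}
        (hN : ∀ μ, N0 ℓ Mh k P' μ = (PV d ℓ m K hd hL).sitesPerDir 0) (D D' : TDomains d ℓ Mh k P' R) (hk : k ≤ m + K),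
        2 ≤ k → ∀ {a : ℕ}, Mh = (ℓ + 1) ^ a → 8 ≤ Mh → 2 * (ℓ + 1) ^ 2 ≤ R → (∀ μ, 5 * (ℓ + 1) ≤ P' μ) → 4 ≤ ℓ →
        (∀ c : ↥(cubes D.toDomains), Placed ℓ k P' c.1) → (∀ c : ↥(cubes D'.toDomains), Placed ℓ k P' c.1) →
        M₀ ≤ ((ℓ : ℝ) + 1) * Mh → N₀ + 1 ≤ R * ((ℓ + 1) * Mh) →
        ∀ {cf : ℝ} (hcf : cf ≠ 0) {w : BondIdx (domT hN D hk) → ℝ} (hw : ∀ i, 0 < w i)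
          {w' : BondIdx (domT hN D' hk) → ℝ} (hw' : ∀ i', 0 < w' i'),
        GlobalBand b₀ b₁ cf w → GlobalBand b₀ b₁ cf w' →
        (∀ (i : BondIdx (domT hN D hk)) (i' : BondIdx (domT hN D' hk)), i.1 = i'.1 → w i = w' i') →
        ∀ (ν : Fin (d + 1)) (x x' : PBond (PV d ℓ m K hd hL) 0), x.dir = x'.dir →
        D.lev (toBox hN x.src).1 = k → D'.lev (toBox hN x.src).1 = k →
        supDist x.src x'.src ≤ (ℓ + 1) ^ k → supDist x.src x'.src ≤ (ℓ + 1) ^ (blkV1 hN D x').1.1 →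
        supDist x.src x'.src ≤ (ℓ + 1) ^ (blkV1 hN D' x').1.1 →
        ∀ (c : BondIdx (domT hN D hk)) (hc : IsCT hN D D' hk c.1),
          |((DV ν cf ∘ₗ onFun (GE (domT hN D hk) hcf hw ∘ₗ QsE (domT hN D hk) ∘ₗ EE (domT hN D hk) hcf hw)) (Pi.single c 1) x
              - (DV ν cf ∘ₗ onFun (GE (domT hN D hk) hcf hw ∘ₗ QsE (domT hN D hk) ∘ₗ EE (domT hN D hk) hcf hw)) (Pi.single c 1) x')
            - ((DV ν cf ∘ₗ onFun (GE (domT hN D' hk) hcf hw' ∘ₗ QsE (domT hN D' hk) ∘ₗ EE (domT hN D' hk) hcf hw'))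
                  (Pi.single (⟨c.1, hc.2.2⟩ : BondIdx (domT hN D' hk)) 1) x
              - (DV ν cf ∘ₗ onFun (GE (domT hN D' hk) hcf hw' ∘ₗ QsE (domT hN D' hk) ∘ₗ EE (domT hN D' hk) hcf hw'))
                  (Pi.single (⟨c.1, hc.2.2⟩ : BondIdx (domT hN D' hk)) 1) x')|
            ≤ C * ((((supDist x.src x'.src : ℕ) : ℝ) / (((ℓ + 1 : ℕ) : ℝ)) ^ k) ^ α * ((geomT D).len (blkV1 hN D x) * |cf|⁻¹)⁻¹)
                * Real.exp (-(δ * min ((geomT D).dist (blkV1 hN D x) (β hN D hk c))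
                    ((geomT D').dist (blkV1 hN D' x) (β hN D' hk ⟨c.1, hc.2.2⟩))))
                * Real.exp (-(δ * dOmega D D' (blkV1 hN D x).1.2 (β hN D hk c).1.2)) := by
  have hb₁0 : 0 ≤ b₁ := le_trans hb₀.le hb₁
  have hL0 : (0 : ℝ) < (((ℓ + 1 : ℕ) : ℝ)) := by positivity
  -- (2.149) at k levels
  obtain ⟨σ₁, hσ₁, hP27⟩ := prop27_kLevel_unconditional d ℓ hd hL hb₀ hb₁
  obtain ⟨A₁, M₁, c₁, N₁, hA₁, hM₁, hc₁, h27⟩ := hP27 σ₁ hσ₁ le_rfl (1 / 2) (by norm_num) (by norm_num)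
  have hγ := gam0_pos d ℓ hb₁0
  have hδ₃ : 0 < delta3 (1 / 2) (2 * σ₁) := delta3_pos (by norm_num) (by linarith)
  obtain ⟨den, hden⟩ : ∃ den : ℝ, den = 2 * (1 * (4 / delta3 (1 / 2) (2 * σ₁)) * (2 * ((d : ℝ) + 1) * c₁)) + 1 := ⟨_, rfl⟩
  have hden0 : 0 < den := by
    have : 0 ≤ 2 * (1 * (4 / delta3 (1 / 2) (2 * σ₁)) * (2 * ((d : ℝ) + 1) * c₁)) := by positivity
    rw [hden]; linarith
  obtain ⟨δE, hδEdef⟩ : ∃ δE : ℝ, δE = min (delta3 (1 / 2) (2 * σ₁) / 4) (gam0 d ℓ b₁ / A₁ / den) := ⟨_, rfl⟩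
  have hδE : 0 < δE := by
    rw [hδEdef]
    exact lt_min (by positivity) (div_pos (div_pos hγ hA₁) hden0)
  obtain ⟨S, hSdef⟩ : ∃ S : ℝ, S = 2 / gam0 d ℓ b₁ := ⟨_, rfl⟩
  have hS : 0 < S := by rw [hSdef]; positivity
  -- the one-family pair majorants of `P_{x,x′}∇_νG` (r03/p22): `σ = σ₃`, `β = ½`, threshold `M₃` BEFORE `α`
  obtain ⟨σ₃, hσ₃, hU⟩ := ineq2137_grad_kLevel_unif d ℓ hd hL hb₀ hb₁
  obtain ⟨M₃, hM₃, hUα⟩ := hU σ₃ hσ₃ le_rfl (1 / 2) (by norm_num) (by norm_num)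
  have hδG3 : 0 < delta3 (1 / 2) (2 * σ₃) := delta3_pos (by norm_num) (by linarith)
  -- Theorem 3.14 for the Hölder pairs of `∇G` (§1; `δ₁, M_H, N_H` BEFORE `α`) and for `(QGQ*)⁻¹` (file Q3)
  obtain ⟨δ₁, MH, NH, hδ₁, hMH, hNH, hHol⟩ := thm314_gradG_holderPair_flat_V1 d ℓ hd hL hb₀ hb₁
  obtain ⟨δQ, CQ, MQ, NQ, hδQ, hCQ, hMQ, hQ⟩ := thm314_QGQinv_flat_V1 d ℓ hd hL hb₀ hb₁
  -- (2.151)₃ at k levels (r03): `σ = σ₅`, `α_r = ½`, `δ₅, M₅, N₅` BEFORE `α`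
  obtain ⟨σ₅, hσ₅, hP28⟩ := cor28_kLevel_holderPair d ℓ hd hL hb₀ hb₁
  obtain ⟨δ₅, M₅, N₅, hδ₅, hM₅, h28α⟩ := hP28 σ₅ hσ₅ le_rfl (1 / 2) (by norm_num) (by norm_num)
  -- the common rate, the Lemma-2.1 profile and the absorption threshold at that rate
  obtain ⟨δu, hδudef⟩ : ∃ δu : ℝ, δu = min (min δE (delta3 (1 / 2) (2 * σ₃))) (min (min δ₁ δQ) δ₅) := ⟨_, rfl⟩
  have hδu : 0 < δu := by rw [hδudef]; exact lt_min (lt_min hδE hδG3) (lt_min (lt_min hδ₁ hδQ) hδ₅)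
  have hδuE : δu ≤ δE := by rw [hδudef]; exact (min_le_left _ _).trans (min_le_left _ _)
  have hδu3 : δu ≤ delta3 (1 / 2) (2 * σ₃) := by rw [hδudef]; exact (min_le_left _ _).trans (min_le_right _ _)
  have hδu1 : δu ≤ δ₁ := by rw [hδudef]; exact (min_le_right _ _).trans ((min_le_left _ _).trans (min_le_left _ _))
  have hδuQ : δu ≤ δQ := by rw [hδudef]; exact (min_le_right _ _).trans ((min_le_left _ _).trans (min_le_right _ _))
  have hδu5 : δu ≤ δ₅ := by rw [hδudef]; exact (min_le_right _ _).trans (min_le_right _ _)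
  obtain ⟨Nc, c₆, hNc, hc₆, h261⟩ := consts_260_261 d ℓ hδu
  obtain ⟨N₃, hN₃⟩ : ∃ N₃ : ℕ, N₃ = ⌈2 * ((d : ℝ) + 3) * ((ℓ : ℝ) + 1) / δu⌉₊ + 1 := ⟨_, rfl⟩
  have hN₃ge : 2 * ((d : ℝ) + 3) * ((ℓ : ℝ) + 1) ≤ δu * (N₃ : ℝ) := by
    have h1 : 2 * ((d : ℝ) + 3) * ((ℓ : ℝ) + 1) / δu ≤ (N₃ : ℝ) := by
      rw [hN₃]; push_cast; exact (Nat.le_ceil _).trans (by linarith)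
    rw [div_le_iff₀ hδu] at h1; linarith
  obtain ⟨CG0, hCG0def⟩ : ∃ CG0 : ℝ, CG0 = 2 * (((ℓ + 1 : ℕ) : ℝ)) ^ (d + 1) * Real.exp (δu * ((ℓ : ℝ) + 3)) := ⟨_, rfl⟩
  obtain ⟨E7, hE7def⟩ : ∃ E7 : ℝ, E7 = Real.exp (δu * ((ℓ : ℝ) + 7)) := ⟨_, rfl⟩
  have hCG00 : 0 ≤ CG0 := by rw [hCG0def]; positivity
  have hE7 : 0 ≤ E7 := by rw [hE7def]; positivity
  refine ⟨δu / 8, max (max M₁ M₃) (max (max MH MQ) M₅), max (max N₁ Nc) (max (max NH NQ) (max N₅ N₃)), by positivity,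
    lt_max_of_lt_left (lt_max_of_lt_left hM₁), fun α hα0 hα1 => ?_⟩
  -- the constants AFTER `α`
  obtain ⟨A₃, hA₃, hUA⟩ := hUα α hα0 hα1
  obtain ⟨CG, hCG, hHolα⟩ := hHol α hα0 hα1
  obtain ⟨C₅, hC₅, h28⟩ := h28α α hα0 hα1
  obtain ⟨KS, hKSdef⟩ : ∃ KS : ℝ, KS = CG0 * A₃ * (CQ + S * ((ℓ : ℝ) + 1) ^ (d + 5)) * (2 * ((d : ℝ) + 1) * c₆)
      + S * (2 * (((ℓ + 1 : ℕ) : ℝ)) ^ (d + 1) * CG + CG0 * A₃ * (2 + ((ℓ : ℝ) + 1) ^ (d + 5))) * (2 * ((d : ℝ) + 1) * c₆) :=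
    ⟨_, rfl⟩
  have hKS : 0 ≤ KS := by rw [hKSdef]; positivity
  refine ⟨Real.sqrt (2 * C₅) * Real.sqrt (KS * E7) + 1, by positivity, ?_⟩
  intro m K Mh k R P' hN D D' hk hk2 a hMha hM8 hR hP5L hℓ hplD hplD' hM hNR cf hcf w hw w' hw' hB hB' hww ν x x' hdir hxD hxD'
    hs hsD hsD' c hc
  -- standing side conditions
  have hk1 : 1 ≤ k := le_trans (by norm_num) hk2
  have hMh : 1 ≤ Mh := le_trans (by norm_num) hM8
  have hP5 : ∀ μ, 5 ≤ P' μ := fun μ => le_trans (Nat.le_mul_of_pos_right 5 (Nat.succ_pos ℓ)) (hP5L μ)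
  have hP : ∀ μ, 1 ≤ P' μ := fun μ => le_trans (by norm_num) (hP5 μ)
  have hRM : 2 ≤ R * Mh := two_le_RMh hR hM8
  have hM₁' : M₁ ≤ ((ℓ : ℝ) + 1) * Mh := le_trans ((le_max_left _ _).trans (le_max_left _ _)) hM
  have hM₃' : M₃ ≤ ((ℓ : ℝ) + 1) * Mh := le_trans ((le_max_right _ _).trans (le_max_left _ _)) hM
  have hMH' : MH ≤ ((ℓ : ℝ) + 1) * Mh := le_trans (((le_max_left _ _).trans (le_max_left _ _)).trans (le_max_right _ _)) hM
  have hMQ' : MQ ≤ ((ℓ : ℝ) + 1) * Mh := le_trans (((le_max_right _ _).trans (le_max_left _ _)).trans (le_max_right _ _)) hM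
  have hM₅' : M₅ ≤ ((ℓ : ℝ) + 1) * Mh := le_trans ((le_max_right _ _).trans (le_max_right _ _)) hM
  have hN₁' : N₁ + 1 ≤ R * ((ℓ + 1) * Mh) :=
    le_trans (Nat.succ_le_succ ((le_max_left _ _).trans (le_max_left _ _))) hNR
  have hNc' : Nc + 1 ≤ R * ((ℓ + 1) * Mh) :=
    le_trans (Nat.succ_le_succ ((le_max_right _ _).trans (le_max_left _ _))) hNR
  have hNH' : NH + 1 ≤ R * ((ℓ + 1) * Mh) :=
    le_trans (Nat.succ_le_succ (((le_max_left _ _).trans (le_max_left _ _)).trans (le_max_right _ _))) hNR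
  have hNQ' : NQ + 1 ≤ R * ((ℓ + 1) * Mh) :=
    le_trans (Nat.succ_le_succ (((le_max_right _ _).trans (le_max_left _ _)).trans (le_max_right _ _))) hNR
  have hN₅' : N₅ + 1 ≤ R * ((ℓ + 1) * Mh) :=
    le_trans (Nat.succ_le_succ (((le_max_left _ _).trans (le_max_right _ _)).trans (le_max_right _ _))) hNR
  have hN₃' : N₃ + 1 ≤ R * ((ℓ + 1) * Mh) :=
    le_trans (Nat.succ_le_succ (((le_max_right _ _).trans (le_max_right _ _)).trans (le_max_right _ _))) hNR
  have hρ := rho_isPseudoDist hN D hk hMh hP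
  have hρ' := rho_isPseudoDist hN D' hk hMh hP
  have hdT := B6Prop23MultiLevelTorus.isPseudoDist_distT D hMh hP
  have hdT' := B6Prop23MultiLevelTorus.isPseudoDist_distT D' hMh hP
  obtain ⟨hy, hyD', hy', hy'D, hlab⟩ := blkV1_common_top hN D D' x hxD hxD'
  have hyy : (⟨(blkV1 hN D x).1, hyD'⟩ : ↥(bset D'.toDomains)) = blkV1 hN D' x :=
    Subtype.ext (Prod.ext (hy.trans hy'.symm) hlab.symm)
  -- (2.149) in the engine's shape, both families, rate lowered to `δu`
  have hE : ∀ a b : BondIdx (domT hN D hk),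
      |⟪EuclideanSpace.single a (1 : ℝ), EE (domT hN D hk) hcf hw (EuclideanSpace.single b (1 : ℝ))⟫_ℝ| ≤
        (lam hN D hk cf a)⁻¹ * (lam hN D hk cf b)⁻¹ * (S * Real.exp (-(δu * rho hN D hk a b))) := by
    intro a b
    have h := h27 m K hN D hk hk2 hMha hM8 hR hP5 hℓ hplD hM₁' hN₁' hcf hw hB a b
    rw [← hden, ← hδEdef, ← hSdef] at h
    exact inner_weaken (inv_nonneg.2 (lam_pos hN D hk hcf a).le) (inv_nonneg.2 (lam_pos hN D hk hcf b).le) hS.le hδuE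
      (hρ.nonneg a b) h
  have hE' : ∀ a b : BondIdx (domT hN D' hk),
      |⟪EuclideanSpace.single a (1 : ℝ), EE (domT hN D' hk) hcf hw' (EuclideanSpace.single b (1 : ℝ))⟫_ℝ| ≤
        (lam hN D' hk cf a)⁻¹ * (lam hN D' hk cf b)⁻¹ * (S * Real.exp (-(δu * rho hN D' hk a b))) := by
    intro a b
    have h := h27 m K hN D' hk hk2 hMha hM8 hR hP5 hℓ hplD' hM₁' hN₁' hcf hw' hB' a b
    rw [← hden, ← hδEdef, ← hSdef] at h
    exact inner_weaken (inv_nonneg.2 (lam_pos hN D' hk hcf a).le) (inv_nonneg.2 (lam_pos hN D' hk hcf b).le) hS.le hδuE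
      (hρ'.nonneg a b) h
  -- Theorem 3.14 for `(QGQ*)⁻¹` (file Q3), the plain decay dropped, rate lowered to `δu`
  have hEΔ : ∀ (i : BondIdx (domT hN D hk)) (hi : IsCT hN D D' hk i.1) (i' : BondIdx (domT hN D' hk))
      (hi' : IsCT hN D D' hk i'.1),
      |⟪EuclideanSpace.single i (1 : ℝ), EE (domT hN D hk) hcf hw
          (EuclideanSpace.single (⟨i'.1, hi'.2.1⟩ : BondIdx (domT hN D hk)) (1 : ℝ))⟫_ℝ
        - ⟪EuclideanSpace.single (⟨i.1, hi.2.2⟩ : BondIdx (domT hN D' hk)) (1 : ℝ), EE (domT hN D' hk) hcf hw'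
          (EuclideanSpace.single i' (1 : ℝ))⟫_ℝ|
        ≤ CQ * ((lam hN D hk cf i)⁻¹ * (lam hN D' hk cf i')⁻¹)
          * Real.exp (-(δu * dOmega D D' (β hN D hk i).1.2 (β hN D' hk i').1.2)) := by
    intro i hi i' hi'
    have h := hQ m K hN D D' hk hk2 hMha hM8 hR hP5L hℓ hplD hplD' hMQ' hNQ' hcf hw hw' hB hB' hww i hi i' hi'
    refine h.trans ?_
    have hW : 0 ≤ CQ * ((lam hN D hk cf i)⁻¹ * (lam hN D' hk cf i')⁻¹) :=
      mul_nonneg hCQ.le (mul_nonneg (inv_nonneg.2 (lam_pos hN D hk hcf i).le) (inv_nonneg.2 (lam_pos hN D' hk hcf i').le))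
    have hmin : 0 ≤ min (rho hN D hk i ⟨i'.1, hi'.2.1⟩) (rho hN D' hk ⟨i.1, hi.2.2⟩ i') :=
      le_min (hρ.nonneg _ _) (hρ'.nonneg _ _)
    have h1 : Real.exp (-(δQ * min (rho hN D hk i ⟨i'.1, hi'.2.1⟩) (rho hN D' hk ⟨i.1, hi.2.2⟩ i'))) ≤ 1 := by
      rw [Real.exp_le_one_iff, neg_nonpos]; exact mul_nonneg hδQ.le hmin
    calc CQ * ((lam hN D hk cf i)⁻¹ * (lam hN D' hk cf i')⁻¹)
          * Real.exp (-(δQ * min (rho hN D hk i ⟨i'.1, hi'.2.1⟩) (rho hN D' hk ⟨i.1, hi.2.2⟩ i')))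
          * Real.exp (-(δQ * dOmega D D' (β hN D hk i).1.2 (β hN D' hk i').1.2))
        ≤ CQ * ((lam hN D hk cf i)⁻¹ * (lam hN D' hk cf i')⁻¹) * 1
          * Real.exp (-(δu * dOmega D D' (β hN D hk i).1.2 (β hN D' hk i').1.2)) :=
          mul_le_mul (mul_le_mul_of_nonneg_left h1 hW) (exp_weaken hδuQ (dOmega_nonneg D D' _ _)) (Real.exp_pos _).le
            (by rw [mul_one]; exact hW)
      _ = _ := by rw [mul_one]
  -- the absorption threshold and the profiles at rate `δu`
  have hN₃le : (N₃ : ℝ) ≤ (R : ℝ) * (((ℓ : ℝ) + 1) * Mh) - 1 := by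
    have h2 : ((N₃ + 1 : ℕ) : ℝ) ≤ ((R * ((ℓ + 1) * Mh) : ℕ) : ℝ) := by exact_mod_cast hN₃'
    push_cast at h2; linarith
  have hsmall : ((ℓ : ℝ) + 1) ^ (d + 3) * Real.exp (-(δu / 2 * ((R : ℝ) * (((ℓ : ℝ) + 1) * Mh) - 1))) ≤ 1 :=
    absorb_threshold hδu hN₃ge hN₃le
  have h261D : Ineq261With c₆ (geomT D) δu (1 / 4) := (h261 k Mh R P' hMh hP hNc').2 D
  have h261D' : Ineq261With c₆ (geomT D') δu (1 / 4) := (h261 k Mh R P' hMh hP hNc').2 D'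
  -- the Hölder gain `t = (|x − x′|_∞/L^k)^α` and the prefactors `Φ = t·len·|c_f|⁻¹` of both families
  obtain ⟨t, ht⟩ : ∃ t : ℝ, t = (((supDist x.src x'.src : ℕ) : ℝ) / (((ℓ + 1 : ℕ) : ℝ)) ^ k) ^ α := ⟨_, rfl⟩
  have ht0 : 0 ≤ t := by rw [ht]; exact Real.rpow_nonneg (by positivity) _
  have hΦ0 : ∀ y : ↥(bset D.toDomains), 0 ≤ t * ((geomT D).len y * |cf|⁻¹) := fun y =>
    mul_nonneg ht0 (len_mul_inv_pos D hcf y).le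
  have hΦ0' : ∀ y : ↥(bset D'.toDomains), 0 ≤ t * ((geomT D').len y * |cf|⁻¹) := fun y =>
    mul_nonneg ht0 (len_mul_inv_pos D' hcf y).le
  have hφ := len_mul_inv_pos D hcf (blkV1 hN D x)
  have hlenf : (geomT D').len (blkV1 hN D' x) * |cf|⁻¹ = (geomT D).len (blkV1 hN D x) * |cf|⁻¹ := by
    rw [geomT_len, geomT_len, hy', hy]
  have hΦf : t * ((geomT D').len (blkV1 hN D' x) * |cf|⁻¹) = t * ((geomT D).len (blkV1 hN D x) * |cf|⁻¹) := by rw [hlenf]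
  have hr : t * ((geomT D).len (blkV1 hN D x) * |cf|⁻¹) / pref cf (blkV1 hN D x) = t * ((geomT D).len (blkV1 hN D x) * |cf|⁻¹)⁻¹ := by
    rw [pref_eq_len_sq D cf, sq, mul_div_assoc, ← div_div, div_self hφ.ne', one_div]
  have hr0 : 0 ≤ t * ((geomT D).len (blkV1 hN D x) * |cf|⁻¹)⁻¹ := mul_nonneg ht0 (inv_nonneg.2 hφ.le)
  have hCH0 : 0 ≤ C₅ * (t * ((geomT D).len (blkV1 hN D x) * |cf|⁻¹)⁻¹) := mul_nonneg hC₅ hr0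
  -- the one-family pair majorants of `T = P_{x,x′}·∇_ν·onFun G` in both families (levels of `x` read as `k`), rate lowered to `δu`
  have hsD1 : supDist x.src x'.src ≤ (ℓ + 1) ^ (blkV1 hN D x).1.1 := by rw [hy]; exact hs
  have hsD'1 : supDist x.src x'.src ≤ (ℓ + 1) ^ (blkV1 hN D' x).1.1 := by rw [hy']; exact hs
  have hMD := hUA m K hN D hk hk2 hMha hM8 hR hP5 hℓ hplD hM₃' hcf hw hB ν x x' hdir hsD1 hsD
  have hMD' := hUA m K hN D' hk hk2 hMha hM8 hR hP5 hℓ hplD' hM₃' hcf hw' hB' ν x x' hdir hsD'1 hsD'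
  rw [hy, ← ht] at hMD
  rw [hy', ← ht] at hMD'
  have hT : HasMajorant (g := geomT D) (blkV1 hN D) (pairOp x x' * DV (P := PV d ℓ m K hd hL) ν cf * onFun (GE (domT hN D hk) hcf hw))
      (fun y y' => A₃ * (t * ((geomT D).len y * |cf|⁻¹)) * Real.exp (-(δu * (geomT D).dist y y'))) :=
    hasMajorant_weaken hN D (F := fun y => A₃ * (t * ((geomT D).len y * |cf|⁻¹))) (fun y => mul_nonneg hA₃ (hΦ0 y)) hδu3 hMD
  have hT' : HasMajorant (g := geomT D') (blkV1 hN D') (pairOp x x' * DV (P := PV d ℓ m K hd hL) ν cf * onFun (GE (domT hN D' hk) hcf hw'))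
      (fun y y' => A₃ * (t * ((geomT D').len y * |cf|⁻¹)) * Real.exp (-(δu * (geomT D').dist y y'))) :=
    hasMajorant_weaken hN D' (F := fun y => A₃ * (t * ((geomT D').len y * |cf|⁻¹))) (fun y => mul_nonneg hA₃ (hΦ0' y)) hδu3 hMD'
  -- Theorem 3.14 for the Hölder pairs of `∇G` (§1) as the two-family bound of `T − T′` block by block, rate lowered to `δu`
  have hTΔ : ∀ (y : ↥(bset D.toDomains)) (hyD2 : y.1 ∈ bset D'.toDomains) (y' : ↥(bset D'.toDomains))
      (hy'D : y'.1 ∈ bset D.toDomains), y.1.1 = k → y'.1.1 = k →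
      ∀ (μ : PBond (PV d ℓ m K hd hL) 0 → ℝ) (B : ℝ), BlockSupp (g := geomT D') (blkV1 hN D') μ y' B →
      ∀ z : PBond (PV d ℓ m K hd hL) 0, blkV1 hN D z = y →
        |(pairOp x x' * DV (P := PV d ℓ m K hd hL) ν cf * onFun (GE (domT hN D hk) hcf hw)) μ z
            - (pairOp x x' * DV (P := PV d ℓ m K hd hL) ν cf * onFun (GE (domT hN D' hk) hcf hw')) μ z|
          ≤ CG * (t * ((geomT D).len y * |cf|⁻¹) * B)
            * Real.exp (-(δu * min ((geomT D).dist y ⟨y'.1, hy'D⟩) ((geomT D').dist ⟨y.1, hyD2⟩ y')))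
            * Real.exp (-(δu * dOmega D D' y.1.2 y'.1.2)) := by
    intro y hyD2 y' hy'D hyk hy'k μ B hμ z hz
    have hW : 0 ≤ t * ((geomT D).len y * |cf|⁻¹) * B := mul_nonneg (hΦ0 y) hμ.nonneg
    rw [pairOp_mul_eq_comp hN D hk hcf hw ν x x', pairOp_mul_eq_comp hN D' hk hcf hw' ν x x']
    simp only [LinearMap.comp_apply, pairOp_apply]
    by_cases hzx : z = x
    · rw [if_pos hzx, if_pos hzx]
      rw [hzx] at hz
      subst hz
      have h := hHolα m K hN D D' hk hk2 hMha hM8 hR hP5L hℓ hplD hplD' hMH' hNH' hcf hw hw' hB hB' hww ν x x' hdir hxD hxD'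
        hs hsD hsD' y' hy'D hy'k μ B hμ
      rw [← ht, ← hyy] at h
      simp only [LinearMap.comp_apply] at h
      exact twoFamily_weaken le_rfl hCG.le hW hδu1 (le_min (hdT.nonneg _ _) (hdT'.nonneg _ _)) (dOmega_nonneg D D' _ _) h
    · rw [if_neg hzx, if_neg hzx, sub_zero, abs_zero]
      exact mul_nonneg (mul_nonneg (mul_nonneg hCG.le hW) (Real.exp_pos _).le) (Real.exp_pos _).le
  -- (2.151)₃ at the pair `x, x′`, both families, rate lowered to `δu` (the trivial bounds of the engine)
  have hH : ∀ a : BondIdx (domT hN D hk),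
      |((pairOp x x' * DV (P := PV d ℓ m K hd hL) ν cf * onFun (GE (domT hN D hk) hcf hw)) ∘ₗ onFun (QsE (domT hN D hk) ∘ₗ EE (domT hN D hk) hcf hw))
          (Pi.single a 1) x|
        ≤ C₅ * (t * ((geomT D).len (blkV1 hN D x) * |cf|⁻¹)⁻¹) * Real.exp (-(δu * (geomT D).dist (blkV1 hN D x) (β hN D hk a))) :=
    fun a => by
    rw [holderH_apply_eq_comp hN D hk hcf hw ν x x']
    have h := h28 m K hN D hk hk2 hMha hM8 hR hP5 hℓ hplD hM₅' hN₅' hcf hw hB ν x x' hdir hsD1 hsD a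
    rw [hy, ← ht] at h
    exact h.trans (mul_le_mul_of_nonneg_left (exp_weaken hδu5 (hdT.nonneg _ _)) hCH0)
  have hH' : ∀ a' : BondIdx (domT hN D' hk),
      |((pairOp x x' * DV (P := PV d ℓ m K hd hL) ν cf * onFun (GE (domT hN D' hk) hcf hw')) ∘ₗ onFun (QsE (domT hN D' hk) ∘ₗ EE (domT hN D' hk) hcf hw'))
          (Pi.single a' 1) x|
        ≤ C₅ * (t * ((geomT D).len (blkV1 hN D x) * |cf|⁻¹)⁻¹)
          * Real.exp (-(δu * (geomT D').dist (blkV1 hN D' x) (β hN D' hk a'))) := fun a' => by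
    rw [holderH_apply_eq_comp hN D' hk hcf hw' ν x x']
    have h := h28 m K hN D' hk hk2 hMha hM8 hR hP5 hℓ hplD' hM₅' hN₅' hcf hw' hB' ν x x' hdir hsD'1 hsD' a'
    rw [hy', ← ht, hlenf] at h
    exact h.trans (mul_le_mul_of_nonneg_left (exp_weaken hδu5 (hdT'.nonneg _ _)) hCH0)
  -- the engine at `T = P_{x,x′}·∇_ν·onFun G`, `Φ = t·len·|c_f|⁻¹`
  have H := thm314_TH_of_hyps hN D D' hk hcf hw hw' hk1 hRM hMh hP (Φ := fun y => t * ((geomT D).len y * |cf|⁻¹))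
    (Φ' := fun y => t * ((geomT D').len y * |cf|⁻¹)) hΦ0 hΦ0' hA₃ hS.le hCQ.le hCG.le hδu.le hCH0
    hT hT' hE hE' hEΔ hTΔ hsmall h261D h261D' c hc x hxD hxD' hΦf hH hH'
  rw [← hCG0def, ← hKSdef, ← hE7def, hr, show 2 * (C₅ * (t * ((geomT D).len (blkV1 hN D x) * |cf|⁻¹)⁻¹))
      = 2 * C₅ * (t * ((geomT D).len (blkV1 hN D x) * |cf|⁻¹)⁻¹) by ring,
    show KS * (t * ((geomT D).len (blkV1 hN D x) * |cf|⁻¹)⁻¹) * E7 = KS * E7 * (t * ((geomT D).len (blkV1 hN D x) * |cf|⁻¹)⁻¹) by ring,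
    sqrt_mul_sqrt_factor (mul_nonneg zero_le_two hC₅) (mul_nonneg hKS hE7) hr0,
    holderH_apply_eq_comp hN D hk hcf hw ν x x', holderH_apply_eq_comp hN D' hk hcf hw' ν x x'] at H
  rw [← ht]
  refine H.trans ?_
  -- constants and rates of the conclusion (light arithmetic)
  have hm0 : 0 ≤ min ((geomT D).dist (blkV1 hN D x) (β hN D hk c)) ((geomT D').dist (blkV1 hN D' x) (β hN D' hk ⟨c.1, hc.2.2⟩)) :=
    le_min (hdT.nonneg _ _) (hdT'.nonneg _ _)
  have he1 := exp_weaken (div_le_div_of_nonneg_left hδu.le (by norm_num) (by norm_num) : δu / 8 ≤ δu / 4) hm0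
  have hC0 : 0 ≤ Real.sqrt (2 * C₅) * Real.sqrt (KS * E7) := mul_nonneg (Real.sqrt_nonneg _) (Real.sqrt_nonneg _)
  have hC10 : 0 ≤ Real.sqrt (2 * C₅) * Real.sqrt (KS * E7) + 1 := add_nonneg hC0 zero_le_one
  have hC1 : Real.sqrt (2 * C₅) * Real.sqrt (KS * E7) ≤ Real.sqrt (2 * C₅) * Real.sqrt (KS * E7) + 1 :=
    le_add_of_nonneg_right zero_le_one
  exact mul_le_mul (mul_le_mul (mul_le_mul_of_nonneg_right hC1 hr0) he1 (Real.exp_pos _).le (mul_nonneg hC10 hr0)) le_rfl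
    (Real.exp_pos _).le (mul_nonneg (mul_nonneg hC10 hr0) (Real.exp_pos _).le)

end HolderH

end Literature.MathematicalPhysics.QuantumFieldTheory.Balaban1983to89.B9Thm314HFlatV1Holder

end
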